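import Summits.Ventures.HSemireg.WedgeHankelBox
import Summits.Ventures.HSemireg.WedgeHankelPureKernel

/-!
# Venture HSemireg — THE KERNEL OF THE POINT CLASS IS THE IDEAL OF THE `y`-FRAME: `Kr(univ, w_m(0,…,0,c), k) = Σ_a y_a ∧ ⋀^{k−1}`
# — the last pure face (`λ = ∞`, «pt») of the one-factor kernel dictionary, every degree; its dimension by a monomial count

HONEST FRAMING. Part of the Lean index of the computation cell `pub-hsemireg` (seat p10 gen 13, Sunday typer «UNIFORM-IN-n»).
Finite-dimensional EXTERIOR ALGEBRA over a field ONLY: no variety, no cohomology theory, no sheaf, no Ext group and no semiregularity map is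
constructed here; nothing here says that HC / HC_CM / HC_AV holds; no Literature fact is declared or used.  Custodian versions cited:
theory/FORMULA-N.md PART A §2.6 THEOREM H and its KRONECKER DICTIONARY («ρ = 1 pure (line bundle / 𝒪 / pt)»), §2.2 THEOREM T; PART B §N.8;
STRUCTURE.md v1.0-SIGNED 9b196a05977dd067 §1.1 C15.  The dictionary (`c·Θ^m/m!` = the class of a point ↦ th-7's `w_m(0,…,0,c) = c·E_Y`; `𝒪 ↦ E_X`;
`⌟v` on `HT^k` ↦ `θ ↦ θ ∧ w_m(q)` on `⋀^k K^{2m}`) is QUOTED, never asserted.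

WHAT IS KEYED.  `WedgeHankelPureKernel` (C6, 732): the pure classes `A·exp(λΘ)` of FINITE slope — `Kr(univ, w_m(Aλ^•), k) = Σ_a (x_a + λ y_a) ∧
⋀^{k−1}` (`λ = 0` is `𝒪 ↦ E_X`); `WedgeHankelBox` (585): th-7's two-ended class `w_m(a,0,…,0,c) = a·E_X + c·E_Y` (`w_ppSeq`, THEOREM T's glue).
The remaining Hankel-rank-1 face is the slope-`∞` class `w_m(0,…,0,c) = c·E_Y` (the POINT).  THIS FILE (a mirror of C6 §4 in the `y`-block):
* §1 `w_m(0,…,0,c) = c·E_{y-block}` (`w_ppSeq` at `a = 0`, `m ≥ 1`); the `y`-block is th-7's `WedgePair.Yset`.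
* §2 **`Kr_B_Yset`: `Kr(univ, E_{y-block}, k)` = the span of the degree-`k` monomials MEETING the `y`-block** (`yIdeal`; th-7's
  `eq_zero_of_mul_B_eq_zero` on the `x`-supported part + `WedgeWeilSpan`'s support projectors) **= `Σ_a y_a ∧ Hom(univ, k−1)`** for `k ≥ 1`
  (`yIdeal_eq_frameIdeal`, C6's `frameIdeal` with the `y`-frame).
* §3 **THE POINT KERNEL, NAMED — `Kr_w_point`: for `c ≠ 0`, `m ≥ 1`, every `k ≥ 1`: `Kr(univ, w_m(0,…,0,c), k) = Σ_{a<m} y_a ∧ Hom(univ, k−1)`**;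
  every `y_a` kills the point class (`Y_mem_Kr_one`; the point is never non-degenerate); **dimension by counting monomials:
  `dim + C(m,k) = C(2m,k)`** (`finrank_yIdeal_add`: all degree-`k` monomials minus those inside the `x`-block — basis-level, no rank theorem used),
  hence `dim Kr(univ, w_m(0,…,0,c), k) = C(2m,k) − C(m,k)` (`finrank_Kr_w_point`).
With C6 every Hankel-rank-1 class (`𝒪`, line bundles `exp(λΘ)`, the point) has a NAMED kernel in every degree: the ideal of its `m`-frame; with
C1/C4 (Künneth kernel law) so does every box containing such factors.  NOT typed here: mixed pure classes `A·exp(λΘ) + B·pt` (Hankel rank 2,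
THEOREM T's faces — their kernels are gen 11's Siegel ideal plus excess, by value); anything Ext-side.  Class side only.
Namespace `Summit.Ventures.HSemireg.Wedge.HankelPureKernel` (continued); new names only.
-/

open Module

namespace Summit.Ventures.HSemireg.Wedge.HankelPureKernel

open Summit.Ventures.HSemireg.Wedge Summit.Ventures.HSemireg.Wedge.Kunneth Summit.Ventures.HSemireg.Wedge.KunnethKernel
  Summit.Ventures.HSemireg.Wedge.HankelBox

variable (K : Type*) [Field K] (m : ℕ)

/-! ## §1. The point class is the `y`-block monomial -/

/-- **`w_m(0,…,0,c) = c · E_{y-block}`** (`m ≥ 1`; th-7's two-ended class `a·E_X + c·E_Y` at `a = 0`). -/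
theorem w_ppSeq_zero (hm : 1 ≤ m) (c : K) :
    Hankel.w K m m (ppSeq K m 0 c) = c • B K (Hankel.In m) (WedgePair.Yset m) := by
  rw [w_ppSeq K m hm, PairPowers.pp, WedgePair.pointPair, zero_smul, zero_add]
  rfl

/-! ## §2. The kernel of the `y`-block monomial -/

/-- the degree-`k` monomials MEETING the `y`-block: `yIdeal k := span{E_s : |s| = k, s ∩ y-block ≠ ∅}`. -/
noncomputable def yIdeal (k : ℕ) : Submodule K (HT K (Hankel.In m)) :=
  Weil.Sp K fun s : Finset (Hankel.In m) => s.card = k ∧ ∃ i ∈ s, m ≤ (i : ℕ)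

/-- a monomial meeting the `y`-block kills the `y`-block monomial. -/
lemma B_mul_B_Yset_eq_zero {s : Finset (Hankel.In m)} (hs : ∃ i ∈ s, m ≤ (i : ℕ)) :
    B K (Hankel.In m) s * B K (Hankel.In m) (WedgePair.Yset m) = 0 := by
  obtain ⟨i, hi, him⟩ := hs
  rw [B_mul_B, u_eq_zero K, zero_smul]
  rw [Finset.not_disjoint_iff]
  exact ⟨i, hi, (WedgePair.mem_Yset m).mpr him⟩

/-- **THE KERNEL OF THE `y`-BLOCK MONOMIAL: `Kr(univ, E_{y-block}, k) = yIdeal k`** — a degree-`k` form kills `E_{y-block}` iff every monomial in it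
meets the `y`-block (the `x`-supported part is killed by th-7's `eq_zero_of_mul_B_eq_zero`). -/
theorem Kr_B_Yset (k : ℕ) : Kr K Finset.univ (B K (Hankel.In m) (WedgePair.Yset m)) k = yIdeal K m k := by
  classical
  apply le_antisymm
  · intro θ hθ
    obtain ⟨hθH, hθf⟩ := mem_Kr.mp hθ
    have hθSp : θ ∈ Weil.Sp K (fun s : Finset (Hankel.In m) => s ⊆ Finset.univ ∧ s.card = k) := by rwa [← Weil.Hom_eq_Sp]
    have hsplit := Weil.proj_add_proj_not (K := K) (fun s : Finset (Hankel.In m) => ∀ i ∈ s, ¬ m ≤ (i : ℕ)) θ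
    have hnot : Weil.proj (K := K) (fun s : Finset (Hankel.In m) => ¬ ∀ i ∈ s, ¬ m ≤ (i : ℕ)) θ ∈ yIdeal K m k := by
      have h := Weil.proj_mem_and (P := fun s : Finset (Hankel.In m) => ¬ ∀ i ∈ s, ¬ m ≤ (i : ℕ)) hθSp
      refine Weil.Sp_mono (fun s hs => ⟨hs.1.2, ?_⟩) h
      have h' := hs.2
      push Not at h'
      exact h'
    have hyz : Weil.proj (K := K) (fun s : Finset (Hankel.In m) => ∀ i ∈ s, ¬ m ≤ (i : ℕ)) θ = 0 := by
      have hx : Weil.proj (K := K) (fun s : Finset (Hankel.In m) => ∀ i ∈ s, ¬ m ≤ (i : ℕ)) θ ∈ Alg K (Hankel.In m) (WedgePair.Xset m) := by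
        refine Weil.Sp_mono (fun s hs => ?_) (Weil.proj_mem _ θ)
        intro i hi
        exact (WedgePair.mem_Xset m).mpr (by have := hs i hi; omega)
      refine eq_zero_of_mul_B_eq_zero K (WedgePair.disjoint_XY m) hx ?_
      have h0 : (Weil.proj (K := K) (fun s : Finset (Hankel.In m) => ∀ i ∈ s, ¬ m ≤ (i : ℕ)) θ +
          Weil.proj (K := K) (fun s : Finset (Hankel.In m) => ¬ ∀ i ∈ s, ¬ m ≤ (i : ℕ)) θ) * B K (Hankel.In m) (WedgePair.Yset m) = 0 := by
        rw [hsplit]; exact hθf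
      have hgen : ∀ z ∈ yIdeal K m k, z * B K (Hankel.In m) (WedgePair.Yset m) = 0 := by
        intro z hz
        rw [yIdeal, Weil.Sp] at hz
        induction hz using Submodule.span_induction with
        | mem x hx' => obtain ⟨s, hs, rfl⟩ := hx'; exact B_mul_B_Yset_eq_zero K m hs.2
        | zero => rw [zero_mul]
        | add x y _ _ hx' hy' => rw [add_mul, hx', hy', add_zero]
        | smul a x _ hx' => rw [smul_mul_assoc, hx', smul_zero]
      have h1 := hgen _ hnot
      rwa [add_mul, h1, add_zero] at h0
    rw [← hsplit, hyz, zero_add]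
    exact hnot
  · rw [yIdeal, Weil.Sp, Submodule.span_le]
    rintro _ ⟨s, hs, rfl⟩
    exact mem_Kr.mpr ⟨B_mem_Hom K (Finset.subset_univ s) hs.1, B_mul_B_Yset_eq_zero K m hs.2⟩

/-- **`yIdeal k = Σ_{a<m} y_a ∧ Hom(univ, k−1)` for `k ≥ 1`** (C6's `frameIdeal` with the `y`-frame). -/
theorem yIdeal_eq_frameIdeal {k : ℕ} (hk : 1 ≤ k) : yIdeal K m k = frameIdeal K m (Hankel.Y K m) k := by
  classical
  apply le_antisymm
  · rw [yIdeal, Weil.Sp, Submodule.span_le]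
    rintro _ ⟨s, ⟨hsk, i, hi, him⟩, rfl⟩
    have hi2 := i.2
    have ha : (i : ℕ) - m < m := by omega
    have hiy : Hankel.yI ((i : ℕ) - m) ha = i := Fin.ext (by simp [Hankel.yI]; omega)
    have hsplit : B K (Hankel.In m) s = (u K {i} (s.erase i))⁻¹ • (B K (Hankel.In m) {i} * B K (Hankel.In m) (s.erase i)) := by
      have hdis : Disjoint ({i} : Finset (Hankel.In m)) (s.erase i) :=
        Finset.disjoint_singleton_left.mpr (Finset.notMem_erase i s)
      rw [B_mul_B, smul_smul, inv_mul_cancel₀ ((u_ne_zero_iff K).mpr hdis), one_smul, ← Finset.insert_eq, Finset.insert_erase hi]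
    show B K (Hankel.In m) s ∈ _
    rw [hsplit]
    refine Submodule.smul_mem _ _ (Submodule.mem_iSup_of_mem ((i : ℕ) - m) (Submodule.mem_iSup_of_mem (Finset.mem_range.mpr ha)
      (Submodule.mul_mem_mul ?_ (B_mem_Hom K (Finset.subset_univ _) ?_))))
    · rw [Hankel.Y, dif_pos ha, gx, hiy]
      exact Submodule.mem_span_singleton_self _
    · rw [Finset.card_erase_of_mem hi, hsk]
  · refine iSup₂_le fun a ha => Submodule.mul_le.mpr fun x hx y hy => ?_
    have ham : a < m := Finset.mem_range.mp ha
    obtain ⟨c, rfl⟩ := Submodule.mem_span_singleton.mp hx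
    rw [smul_mul_assoc]
    refine Submodule.smul_mem _ _ ?_
    rw [Hankel.Y, dif_pos ham, gx]
    induction hy using Submodule.span_induction with
    | mem z hz =>
      obtain ⟨t, ⟨-, htk⟩, rfl⟩ := hz
      rw [B_mul_B]
      by_cases hdis : Disjoint ({Hankel.yI a ham} : Finset (Hankel.In m)) t
      · refine Submodule.smul_mem _ _ (Submodule.subset_span ⟨_, ⟨?_, Hankel.yI a ham, ?_, ?_⟩, rfl⟩)
        · rw [Finset.card_union_of_disjoint hdis, Finset.card_singleton, htk]; omega
        · exact Finset.mem_union_left _ (Finset.mem_singleton_self _)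
        · simp [Hankel.yI]
      · rw [u_eq_zero K hdis, zero_smul]; exact Submodule.zero_mem _
    | zero => rw [mul_zero]; exact Submodule.zero_mem _
    | add z w _ _ hz hw => rw [mul_add]; exact Submodule.add_mem _ hz hw
    | smul c' z _ hz => rw [mul_smul_comm]; exact Submodule.smul_mem _ _ hz

/-! ## §3. The kernel of the point class, named; its dimension by counting monomials -/

/-- **THE POINT KERNEL, NAMED: `Kr(univ, w_m(0,…,0,c), k) = Σ_{a<m} y_a ∧ Hom(univ, k−1)`** (`c ≠ 0`, `m ≥ 1`, `k ≥ 1`; every field) — the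
degree-`k` part of the ideal of the `y`-frame. -/
theorem Kr_w_point (hm : 1 ≤ m) {c : K} (hc : c ≠ 0) {k : ℕ} (hk : 1 ≤ k) :
    Kr K Finset.univ (Hankel.w K m m (ppSeq K m 0 c)) k = frameIdeal K m (Hankel.Y K m) k := by
  rw [w_ppSeq_zero K m hm, Kr_smul K _ hc, Kr_B_Yset, yIdeal_eq_frameIdeal K m hk]

/-- monomial form, every degree: `Kr(univ, w_m(0,…,0,c), k) = yIdeal k`. -/
theorem Kr_w_point_eq_yIdeal (hm : 1 ≤ m) {c : K} (hc : c ≠ 0) (k : ℕ) :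
    Kr K Finset.univ (Hankel.w K m m (ppSeq K m 0 c)) k = yIdeal K m k := by
  rw [w_ppSeq_zero K m hm, Kr_smul K _ hc, Kr_B_Yset]

/-- **every `y_a` kills the point class** (`a < m`): the point is never non-degenerate. -/
theorem Y_mem_Kr_one (hm : 1 ≤ m) (c : K) {a : ℕ} (ha : a < m) :
    Hankel.Y K m a ∈ Kr K Finset.univ (Hankel.w K m m (ppSeq K m 0 c)) 1 := by
  rw [w_ppSeq_zero K m hm]
  refine mem_Kr.mpr ⟨?_, ?_⟩
  · rw [Hankel.Y, dif_pos ha]; exact B_mem_Hom K (Finset.subset_univ _) (Finset.card_singleton _)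
  · rw [mul_smul_comm, Hankel.Y, dif_pos ha, gx, B_mul_B, u_eq_zero K, zero_smul, smul_zero]
    rw [Finset.disjoint_singleton_left, WedgePair.mem_Yset, not_not]
    simp [Hankel.yI]

/-- counting: the degree-`k` monomials NOT meeting the `y`-block are those inside the `x`-block, `C(m, k)` of them; all: `C(2m, k)`. -/
lemma card_filter_meets_Yset (k : ℕ) :
    (Finset.univ.filter fun s : Finset (Hankel.In m) => s.card = k ∧ ∃ i ∈ s, m ≤ (i : ℕ)).card + m.choose k = (m + m).choose k := by
  classical
  have hsplit : (Finset.univ.filter fun s : Finset (Hankel.In m) => s.card = k) =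
      (Finset.univ.filter fun s : Finset (Hankel.In m) => s.card = k ∧ ∃ i ∈ s, m ≤ (i : ℕ)) ∪
        (WedgePair.Xset m).powersetCard k := by
    ext s
    simp only [Finset.mem_filter, Finset.mem_univ, true_and, Finset.mem_union, Finset.mem_powersetCard]
    constructor
    · intro hs
      by_cases h : ∃ i ∈ s, m ≤ (i : ℕ)
      · exact Or.inl ⟨hs, h⟩
      · refine Or.inr ⟨fun i hi => (WedgePair.mem_Xset m).mpr ?_, hs⟩
        by_contra hlt
        exact h ⟨i, hi, by omega⟩
    · rintro (⟨hs, -⟩ | ⟨-, hs⟩) <;> exact hs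
  have hdis : Disjoint (Finset.univ.filter fun s : Finset (Hankel.In m) => s.card = k ∧ ∃ i ∈ s, m ≤ (i : ℕ))
      ((WedgePair.Xset m).powersetCard k) := by
    rw [Finset.disjoint_left]
    intro s hs hs'
    obtain ⟨-, i, hi, him⟩ := (Finset.mem_filter.mp hs).2
    have hx := (Finset.mem_powersetCard.mp hs').1 hi
    rw [WedgePair.mem_Xset] at hx
    omega
  have hall : (Finset.univ.filter fun s : Finset (Hankel.In m) => s.card = k).card = (m + m).choose k := by
    rw [show (Finset.univ.filter fun s : Finset (Hankel.In m) => s.card = k) = (Finset.univ : Finset (Hankel.In m)).powersetCard k by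
      ext s; simp [Finset.mem_powersetCard], Finset.card_powersetCard, Finset.card_univ, Fintype.card_fin]
  rw [← hall, hsplit, Finset.card_union_of_disjoint hdis, Finset.card_powersetCard, WedgePair.card_Xset]

/-- **`dim yIdeal k + C(m, k) = C(2m, k)`** (a monomial count: `WedgeWeilSpan.finrank_Sp`). -/
theorem finrank_yIdeal_add (k : ℕ) : finrank K (yIdeal K m k) + m.choose k = (m + m).choose k := by
  classical
  rw [yIdeal, Weil.finrank_Sp]
  convert card_filter_meets_Yset m k using 2

/-- **`dim Kr(univ, w_m(0,…,0,c), k) = C(2m, k) − C(m, k)`** (`c ≠ 0`, `m ≥ 1`, every `k`): the point class has th-6's pure profile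
`(1+t)^m` on the kernel side too — by COUNTING MONOMIALS, independently of THEOREM H. -/
theorem finrank_Kr_w_point (hm : 1 ≤ m) {c : K} (hc : c ≠ 0) (k : ℕ) :
    finrank K (Kr K Finset.univ (Hankel.w K m m (ppSeq K m 0 c)) k) = (m + m).choose k - m.choose k := by
  have h := finrank_yIdeal_add K m k
  rw [Kr_w_point_eq_yIdeal K m hm hc]
  omega

/-- hence the Hankel rank of the point sequence, read off the wedge model: **`C(m,k)·rank H_k(0,…,0,c) = C(m,k)`** (`c ≠ 0`, `m ≥ 1`; by C1's
per-degree rank–nullity and THEOREM H; i.e. `rank H_k = 1` for `k ≤ m`). -/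
theorem choose_mul_rank_hankel1_point (hm : 1 ≤ m) {c : K} (hc : c ≠ 0) (k : ℕ) :
    m.choose k * (Hankel.hankel1 K m k (ppSeq K m 0 c)).rank = m.choose k := by
  have h1 := finrank_Kr_add_finrank_V K (Finset.univ : Finset (Hankel.In m)) (Hankel.w K m m (ppSeq K m 0 c)) k
  rw [Finset.card_univ, Fintype.card_fin, V_univ] at h1
  have h2 : finrank K (LinearMap.range (wedge K (Hankel.In m) k (Hankel.w K m m (ppSeq K m 0 c)))) =
      m.choose k * (Hankel.hankel1 K m k (ppSeq K m 0 c)).rank := Hankel.hankelLaw_model K k _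
  have h3 := finrank_yIdeal_add K m k
  rw [← Kr_w_point_eq_yIdeal K m hm hc] at h3
  omega

end Summit.Ventures.HSemireg.Wedge.HankelPureKernel
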